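import Mathlib

/-!
# Square-difference-free sets in `ℤ[i]` of exponent `3/4` (base-`3` digits with a Paley coclique of `𝔽₉`)

Wall-breaker seat k2/12 (axis "parabola lifts over finite fields") for the stub `stub_tangencySets` of the
crux `LevelOneGL2Designs` (stmt-MatrixMultiplication-14080).  This file is the additive-combinatorial
input of the *Gaussian parabola lift* (`…GaussLift.lean`), which gives strong representative systems of
`AG(2,p)` of size `≫ p^{5/4}` for every prime `p ≡ 1 (mod 4)` — beyond the record `p^{1.2334}` of
Hunter–Pohoata–Verstraëte–Zhang (arXiv:2601.19879, 2026, Thm 1.2), whose input is a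
square-difference-free set of *rational* integers (exponent `0.7334`, Ruzsa/Lewko).

We encode a Gaussian integer `a + bi` with `a, b ≥ 0` as the pair `(a, b) : ℕ × ℕ`; the square of
`c + di` (`c d : ℤ`) is `(c² - d², 2cd)`.  A finite `K ⊆ ℕ × ℕ` is *Gaussian-square-difference-free* if

  `∀ k k' ∈ K, ∀ c d : ℤ, k.1 - k'.1 = c² - d² → k.2 - k'.2 = 2cd → c = 0 ∧ d = 0`

(for `k = k'` this correctly says that `0` is the only square root of `0`).  Ruzsa's digit construction
(1984) in base `3`, which is a Gaussian prime with residue field `𝔽₉ = ℤ[i]/(3)`: digits at even positions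
from `R = {0, 1+i, 2+2i}` — a coclique of the Paley graph of `𝔽₉`, i.e. `±(1+i)` is a non-square mod `3`
— and arbitrary digits `{0,1,2} + {0,1,2}·i` at odd positions give

* `exists_gaussSqDiffFree` — for every `t`, a Gaussian-square-difference-free `K ⊆ [0,9^t)²` with
  `|K| = 27^t = (81^t)^{3/4}`.

The whole residue computation is one decidable fact (`gaussSq_mod_three`): a Gaussian square
`(c² - d², 2cd)` is congruent mod `3` to a "diagonal" element `(v, v)` only if `3 ∣ c` and `3 ∣ d` (and
then `v ≡ 0`).  Proof of the step (`gaussSqDiffFree_step`): for `n = r + 3e + 9k`, `n' = r' + 3e' + 9k'`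
(`r = (ρ,ρ)`, `r' = (ρ',ρ')`) and a square `(c²-d², 2cd) = n - n'`, reduction mod `3` gives
`c² - d² ≡ ρ - ρ' ≡ 2cd`, so `3 ∣ c, d` and `ρ = ρ'`; then `9` divides the square, forcing `e = e'`, and
dividing by `9` reduces to the hypothesis on `K` with `(c/3, d/3)`.  New as a statement about `ℤ[i]`
(see `NumberRingLift.md` of the seat) but entirely elementary; no definitions are introduced.
-/

-- justification: the summit/problem path `MatrixMultiplication.MatrixMultiplication` is fixed by the
-- tree layout (D-0017), so the namespace necessarily repeats a component.
set_option linter.dupNamespace false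

namespace Summit.MatrixMultiplication.MatrixMultiplication.Theorems.LevelOneGL2Designs.ParabolaLift

open Finset

/-- **Gaussian squares mod `3`.**  If the square `(c² - d², 2cd)` of `c + di` is congruent mod `3` to a
diagonal element `(v, v)`, then `c ≡ d ≡ 0 (mod 3)`: the non-zero diagonal residues `±(1+i)` are
non-squares in `𝔽₉ = ℤ[i]/(3)`, and `3` is inert. [elementary] -/
theorem gaussSq_mod_three (c d : ZMod 3) (h : c ^ 2 - d ^ 2 = 2 * c * d) : c = 0 ∧ d = 0 := by
  revert c d
  decide

/-- **One base-`3` double-digit step in `ℤ[i]`.**  If `K ⊆ [0,W)²` is Gaussian-square-difference-free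
then so is `{r + 3e + 9k : r ∈ {(0,0),(1,1),(2,2)}, e ∈ {0,1,2}², k ∈ K} ⊆ [0, 9W)²`, and it has `27·|K|`
elements. [elementary; the mechanism is Ruzsa 1984, §2, run in `ℤ[i]` with the inert prime `3`] -/
theorem gaussSqDiffFree_step (W : ℕ) (K : Finset (ℕ × ℕ)) (hKW : ∀ k ∈ K, k.1 < W ∧ k.2 < W)
    (hK : ∀ k ∈ K, ∀ k' ∈ K, ∀ c d : ℤ, (k.1 : ℤ) - k'.1 = c ^ 2 - d ^ 2 →
      (k.2 : ℤ) - k'.2 = 2 * c * d → c = 0 ∧ d = 0) :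
    ∃ K' : Finset (ℕ × ℕ), K'.card = 27 * K.card ∧ (∀ k ∈ K', k.1 < 9 * W ∧ k.2 < 9 * W) ∧
      ∀ k ∈ K', ∀ k' ∈ K', ∀ c d : ℤ, (k.1 : ℤ) - k'.1 = c ^ 2 - d ^ 2 →
        (k.2 : ℤ) - k'.2 = 2 * c * d → c = 0 ∧ d = 0 := by
  classical
  -- the digit data `(ρ, (e₁, e₂), (k₁, k₂)) ↦ (ρ + 3 e₁ + 9 k₁, ρ + 3 e₂ + 9 k₂)`, `ρ ∈ {0,1,2}` being the
  -- common coordinate of the `R`-digit `(ρ, ρ)`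
  have hinj : Set.InjOn (fun x : ℕ × (ℕ × ℕ) × (ℕ × ℕ) =>
      (x.1 + 3 * x.2.1.1 + 9 * x.2.2.1, x.1 + 3 * x.2.1.2 + 9 * x.2.2.2))
      ↑((range 3) ×ˢ ((range 3 ×ˢ range 3) ×ˢ K)) := by
    rintro ⟨ρ, ⟨e₁, e₂⟩, ⟨k₁, k₂⟩⟩ h ⟨ρ', ⟨e₁', e₂'⟩, ⟨k₁', k₂'⟩⟩ h' heq
    simp only [coe_product, coe_range, Set.mem_prod, Set.mem_Iio, mem_coe] at h h'
    simp only [Prod.mk.injEq] at heq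
    obtain ⟨hq1, hq2⟩ := heq
    have hρ : ρ = ρ' := by omega
    subst hρ
    have he1 : e₁ = e₁' := by omega
    have he2 : e₂ = e₂' := by omega
    subst he1
    subst he2
    have hk1 : k₁ = k₁' := by omega
    have hk2 : k₂ = k₂' := by omega
    subst hk1
    subst hk2
    rfl
  refine ⟨((range 3) ×ˢ ((range 3 ×ˢ range 3) ×ˢ K)).image fun x : ℕ × (ℕ × ℕ) × (ℕ × ℕ) =>
      (x.1 + 3 * x.2.1.1 + 9 * x.2.2.1, x.1 + 3 * x.2.1.2 + 9 * x.2.2.2), ?_, ?_, ?_⟩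
  · rw [card_image_of_injOn hinj, card_product, card_product, card_product, card_range]
    ring
  · -- the box
    intro n hn
    simp only [mem_image, mem_product, mem_range, Prod.exists] at hn
    obtain ⟨ρ, e₁, e₂, k₁, k₂, ⟨hρ, ⟨he₁, he₂⟩, hk⟩, rfl⟩ := hn
    have := hKW _ hk
    dsimp only at this ⊢
    constructor <;> omega
  · -- square-difference-freeness
    intro n hn n' hn' c d h1 h2
    simp only [mem_image, mem_product, mem_range, Prod.exists] at hn hn'
    obtain ⟨ρ, e₁, e₂, k₁, k₂, ⟨hρ, ⟨he₁, he₂⟩, hk⟩, rfl⟩ := hn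
    obtain ⟨ρ', e₁', e₂', k₁', k₂', ⟨hρ', ⟨he₁', he₂'⟩, hk'⟩, rfl⟩ := hn'
    dsimp only at h1 h2
    push_cast at h1 h2
    -- reduce mod 3: `c² - d² ≡ ρ - ρ' ≡ 2cd`
    have q1 := congrArg (Int.cast : ℤ → ZMod 3) h1
    have q2 := congrArg (Int.cast : ℤ → ZMod 3) h2
    push_cast at q1 q2
    rw [show (3 : ZMod 3) = 0 by decide, show (9 : ZMod 3) = 0 by decide] at q1 q2
    simp only [zero_mul, add_zero] at q1 q2
    obtain ⟨hc3, hd3⟩ := gaussSq_mod_three (c : ZMod 3) (d : ZMod 3) (q1.symm.trans q2)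
    -- hence `ρ = ρ'`
    have hρρ : ρ = ρ' := by
      have h0 : (((ρ : ℤ) - ρ' : ℤ) : ZMod 3) = 0 := by
        push_cast
        rw [q1, hc3, hd3]
        ring
      have h3 := (ZMod.intCast_zmod_eq_zero_iff_dvd _ 3).mp h0
      omega
    subst hρρ
    -- and `3 ∣ c`, `3 ∣ d`, so `9` divides the square
    obtain ⟨c₁, rfl⟩ := (ZMod.intCast_zmod_eq_zero_iff_dvd c 3).mp hc3
    obtain ⟨d₁, rfl⟩ := (ZMod.intCast_zmod_eq_zero_iff_dvd d 3).mp hd3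
    push_cast at h1 h2
    obtain ⟨C, hC⟩ : ∃ C : ℤ, C = c₁ ^ 2 - d₁ ^ 2 := ⟨_, rfl⟩
    obtain ⟨P, hP⟩ : ∃ P : ℤ, P = c₁ * d₁ := ⟨_, rfl⟩
    have h1' : 3 * ((e₁ : ℤ) - e₁') + 9 * ((k₁ : ℤ) - k₁') = 9 * C := by
      rw [hC]; linear_combination h1
    have h2' : 3 * ((e₂ : ℤ) - e₂') + 9 * ((k₂ : ℤ) - k₂') = 9 * (2 * P) := by
      rw [hP]; linear_combination h2
    have hee1 : e₁ = e₁' := by omega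
    have hee2 : e₂ = e₂' := by omega
    subst hee1
    subst hee2
    -- divide by `9` and use the hypothesis on `K`
    have hk1 : ((k₁ : ℕ) : ℤ) - (k₁' : ℕ) = c₁ ^ 2 - d₁ ^ 2 := by rw [← hC]; linarith
    have hk2 : ((k₂ : ℕ) : ℤ) - (k₂' : ℕ) = 2 * c₁ * d₁ := by rw [mul_assoc, ← hP]; linarith
    obtain ⟨hc0, hd0⟩ := hK _ hk _ hk' c₁ d₁ hk1 hk2
    subst hc0
    subst hd0
    simp

/-- **Gaussian-square-difference-free sets of exponent `3/4`.**  For every `t` there is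
`K ⊆ [0, 9^t)² ⊆ ℤ[i]` with `|K| = 27^t = (81^t)^{3/4}` no two of whose elements differ by the square
of a Gaussian integer. [elementary; new — the rational-integer record exponent is `0.7334` (Lewko 2015)] -/
theorem exists_gaussSqDiffFree (t : ℕ) :
    ∃ K : Finset (ℕ × ℕ), K.card = 27 ^ t ∧ (∀ k ∈ K, k.1 < 9 ^ t ∧ k.2 < 9 ^ t) ∧
      ∀ k ∈ K, ∀ k' ∈ K, ∀ c d : ℤ, (k.1 : ℤ) - k'.1 = c ^ 2 - d ^ 2 →
        (k.2 : ℤ) - k'.2 = 2 * c * d → c = 0 ∧ d = 0 := by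
  classical
  induction t with
  | zero =>
    refine ⟨{(0, 0)}, by simp, by simp, ?_⟩
    simp only [mem_singleton]
    rintro k rfl k' rfl c d h1 h2
    simp only [sub_self] at h1 h2
    have hc2 : c ^ 2 = d ^ 2 := by linarith
    have hcd : c * d = 0 := by linarith
    rcases mul_eq_zero.mp hcd with h | h
    · subst h
      exact ⟨rfl, by nlinarith⟩
    · subst h
      exact ⟨by nlinarith, rfl⟩
  | succ t ih =>
    obtain ⟨K, hcard, hKW, hK⟩ := ih
    obtain ⟨K', hcard', hKW', hK'⟩ := gaussSqDiffFree_step (9 ^ t) K hKW hK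
    refine ⟨K', by rw [hcard', hcard]; ring, ?_, hK'⟩
    intro k hk
    have := hKW' k hk
    rw [pow_succ]
    constructor <;> linarith [this.1, this.2]

end Summit.MatrixMultiplication.MatrixMultiplication.Theorems.LevelOneGL2Designs.ParabolaLift
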